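import Mathlib

set_option linter.dupNamespace false

/-!
# SoloBlindFirstLetterShuffleSum — the first-letter shuffle sum is a single height-one word (solo-blind s121)

Kernel certificate for LEMMA 1″ of `paper/descent6.md` (solo-blind residency, session 121 audit).

Words are lists in the two letters `false` (= the letter `0`) and `true` (= the letter `1`); the first
entry of a list is the first letter.  A *regularised shuffle character* is a map `I : List Bool → K`
which is multiplicative for the shuffle product, `I u * I v = Σ_{s ∈ u ш v} I s`, and vanishes on the
one-letter word `[true]` — e.g. the shuffle-regularised iterated integrals `w ↦ I(0; w; 1)` (real, or
motivic inside the fraction field of the algebra of motivic periods), for which `I [true] = I(0;1;1) = 0`.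

**Theorem** (`firstLetter_sum_eq`, `firstLetter_sum_eq_of_character`).  For every such `I` over a field of
characteristic zero and all `i j : ℕ`,

  `Σ_{w ∈ 0^i ш 1^j} I (1 :: w) = (-1)^j · I (1^(j+1) 0^i)`,

i.e. the sum of `I` over all words with first letter `1`, `j+1` letters `1` and `i` letters `0` is `±` the value
on the single word `1…10…0`.  For iterated integrals this reads: the sum of all shuffle-regularised multiple
zeta values of weight `r` and depth `m` equals `(-1)^(m+1) ζ(r-m+1, 1, …, 1)` — the combinatorial half of the
second proof of THEOREM 1′ of `descent6.md` (the other half being the Aomoto–Drinfeld–Zagier formula).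

Proof (as in the paper): with `P k j := Σ_{w ∈ 0^i ш 1^j} I (1^k w)`, the regularisation relations
`0 = I [1] · I (1^k w) = Σ_{s ∈ 1 ш 1^k w} I s` summed over `w` give `(j+1) P k (j+1) = -k P (k+1) j`
(`key`), using the counting identity `Σ_{w ∈ 0^i ш 1^j} Σ_{s ∈ 1 ш w} g s = (j+1) Σ_{u ∈ 0^i ш 1^(j+1)} g u`
(`ins1_arr_sum`); iterating in `j` gives the claim with a binomial coefficient that collapses at `k = 1`.
Only `Mathlib` is imported; no Literature or Summit declaration is used; `KZPeriodConjecture` is not touched.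
-/

namespace Summit.KontsevichZagierPeriods.KontsevichZagierPeriods.Theorems

namespace FirstLetterShuffle

open List

/-- All shuffles (interleavings, with multiplicity) of two words — the standard recursion. -/
def shuf {α : Type*} : List α → List α → List (List α)
  | [], v => [v]
  | a :: u, [] => [a :: u]
  | a :: u, b :: v => (shuf u (b :: v)).map (a :: ·) ++ (shuf (a :: u) v).map (b :: ·)

/-- The insertions of one letter `a` into a word at every slot (= `shuf [a] w`, see `shuf_singleton`). -/
def ins1 {α : Type*} (a : α) : List α → List (List α)
  | [] => [[a]]
  | b :: v => (a :: b :: v) :: (ins1 a v).map (b :: ·)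

/-- All arrangements of `i` letters `false` and `j` letters `true`
(= `shuf (replicate i false) (replicate j true)`, see `shuf_replicate`). -/
def arr : ℕ → ℕ → List (List Bool)
  | 0, j => [replicate j true]
  | i + 1, 0 => [replicate (i + 1) false]
  | i + 1, j + 1 => (arr i (j + 1)).map (false :: ·) ++ (arr (i + 1) j).map (true :: ·)

section combinatorics

variable {α : Type*}

/-- Defining equation of `shuf`: empty left word. -/
@[simp] theorem shuf_nil_left (v : List α) : shuf [] v = [v] := by
  cases v <;> simp [shuf]

/-- Defining equation of `shuf`: empty right word. -/
@[simp] theorem shuf_cons_nil (a : α) (u : List α) : shuf (a :: u) [] = [a :: u] := by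
  simp [shuf]

/-- Defining equation of `shuf`: two non-empty words. -/
@[simp] theorem shuf_cons_cons (a b : α) (u v : List α) :
    shuf (a :: u) (b :: v) = (shuf u (b :: v)).map (a :: ·) ++ (shuf (a :: u) v).map (b :: ·) := by
  simp [shuf]

/-- Defining equation of `ins1`: empty word. -/
@[simp] theorem ins1_nil (a : α) : ins1 a [] = [[a]] := by simp [ins1]

/-- Defining equation of `ins1`: non-empty word. -/
@[simp] theorem ins1_cons (a b : α) (v : List α) :
    ins1 a (b :: v) = (a :: b :: v) :: (ins1 a v).map (b :: ·) := by simp [ins1]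

/-- `ins1 a w` is the shuffle product `[a] ш w`. -/
theorem shuf_singleton (a : α) (w : List α) : shuf [a] w = ins1 a w := by
  induction w with
  | nil => simp
  | cons b v ih => simp [ih]

/-- Defining equation of `arr`: no letter `0`. -/
@[simp] theorem arr_zero (j : ℕ) : arr 0 j = [replicate j true] := by simp [arr]

/-- Defining equation of `arr`: no letter `1`. -/
@[simp] theorem arr_succ_zero (i : ℕ) : arr (i + 1) 0 = [replicate (i + 1) false] := by simp [arr]

/-- Defining equation of `arr`: first-letter recursion. -/
@[simp] theorem arr_succ_succ (i j : ℕ) :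
    arr (i + 1) (j + 1) = (arr i (j + 1)).map (false :: ·) ++ (arr (i + 1) j).map (true :: ·) := by
  simp [arr]

/-- `arr i 0` is the single word `0^i`. -/
theorem arr_any_zero (i : ℕ) : arr i 0 = [replicate i false] := by
  cases i <;> simp

/-- `arr i j` is the shuffle product `0^i ш 1^j`. -/
theorem shuf_replicate (i j : ℕ) : shuf (replicate i false) (replicate j true) = arr i j := by
  induction i generalizing j with
  | zero => simp
  | succ i ih =>
    induction j with
    | zero => simp [replicate_succ]
    | succ j ihj =>
      have h1 : shuf (replicate i false) (true :: replicate j true) = arr i (j + 1) := ih (j + 1)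
      have h2 : shuf (false :: replicate i false) (replicate j true) = arr (i + 1) j := ihj
      simp only [replicate_succ, shuf_cons_cons, arr_succ_succ]
      rw [h1, h2]

/-- Inserting `a` into `a^k w`: the `k+1` leading slots all give `a^(k+1) w`. -/
theorem sum_ins1_replicate_append {K : Type*} [CommRing K] (a : α) (g : List α → K) (k : ℕ)
    (w : List α) :
    ((ins1 a (replicate k a ++ w)).map g).sum
      = (k : K) * g (replicate (k + 1) a ++ w) + ((ins1 a w).map (fun s => g (replicate k a ++ s))).sum := by
  induction k generalizing g with
  | zero => simp
  | succ k ih =>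
    have ih' := ih (fun s => g (a :: s))
    simp only [replicate_succ, cons_append, ins1_cons, map_cons, sum_cons, map_map, Function.comp_def]
    simp only [replicate_succ, cons_append] at ih'
    rw [ih']
    push_cast
    ring

/-- All insertions of `a` into `a^j` give `a^(j+1)`. -/
theorem ins1_replicate_self (a : α) (j : ℕ) :
    ins1 a (replicate j a) = replicate (j + 1) (replicate (j + 1) a) := by
  induction j with
  | zero => simp
  | succ j ih =>
    rw [replicate_succ, ins1_cons, ih, map_replicate]
    simp [replicate_succ]

/-- The insertions of `1` into `0^i` are the arrangements `arr i 1` (as a sum). -/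
theorem sum_ins1_true_replicate_false {K : Type*} [CommRing K] (g : List Bool → K) (i : ℕ) :
    ((ins1 true (replicate i false)).map g).sum = ((arr i 1).map g).sum := by
  induction i generalizing g with
  | zero => simp
  | succ i ih =>
    have ih' := ih (fun s => g (false :: s))
    have e : arr (i + 1) 1 = (arr i 1).map (false :: ·) ++ [true :: replicate (i + 1) false] := by
      show arr (i + 1) (0 + 1) = _
      rw [arr_succ_succ, arr_succ_zero]
      simp
    rw [e]
    simp only [replicate_succ, ins1_cons, map_cons, sum_cons, map_map, Function.comp_def, map_append,
      sum_append, map_nil, sum_nil, add_zero]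
    rw [ih', add_comm]

/-- The counting identity `Σ_{w ∈ 0^i ш 1^j} Σ_{s ∈ 1 ш w} g s = (j+1) · Σ_{u ∈ 0^i ш 1^(j+1)} g u`
(every arrangement with `j+1` ones arises from exactly `j+1` insertions). -/
theorem ins1_arr_sum {K : Type*} [CommRing K] (i j : ℕ) (g : List Bool → K) :
    ((arr i j).map (fun w => ((ins1 true w).map g).sum)).sum = ((j : K) + 1) * ((arr i (j + 1)).map g).sum := by
  induction i generalizing j g with
  | zero =>
    simp only [arr_zero, map_cons, map_nil, sum_cons, sum_nil, add_zero, ins1_replicate_self, map_replicate,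
      sum_replicate, nsmul_eq_mul]
    push_cast
    ring
  | succ i ihi =>
    induction j generalizing g with
    | zero =>
      simp only [arr_succ_zero, map_cons, map_nil, sum_cons, sum_nil, add_zero, Nat.cast_zero, zero_add, one_mul]
      rw [sum_ins1_true_replicate_false]
    | succ j ihj =>
      have hA := ihi (j + 1) (fun s => g (false :: s))
      have hB := ihj (fun s => g (true :: s))
      simp only [arr_succ_succ, map_append, sum_append, map_map, Function.comp_def, ins1_cons, map_cons,
        sum_cons, sum_map_add] at hB ⊢
      rw [hA, hB]
      push_cast
      ring

end combinatorics

section character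

variable {K : Type*} [Field K] [CharZero K]

/-- **LEMMA 1″ (descent6.md), kernel form.**  For `I : List Bool → K` with `I [true] = 0` satisfying the
regularisation relations `Σ_{s ∈ 1 ш w} I s = I [1] · I w` (the shuffle axiom against the letter `1`):
`Σ_{w ∈ 0^i ш 1^j} I (1 :: w) = (-1)^j · I (1^(j+1) 0^i)`. -/
theorem firstLetter_sum_eq (I : List Bool → K) (h1 : I [true] = 0)
    (hreg : ∀ w : List Bool, ((ins1 true w).map I).sum = I [true] * I w) (i j : ℕ) :
    ((arr i j).map (fun w => I (true :: w))).sum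
      = (-1 : K) ^ j * I (replicate (j + 1) true ++ replicate i false) := by
  -- P k j := Σ_{w ∈ arr i j} I (1^k w)
  let P : ℕ → ℕ → K := fun k j => ((arr i j).map (fun w => I (replicate k true ++ w))).sum
  -- the key relation (j+1) P (k+1) (j+1) = -(k+1) P (k+2) j
  have key : ∀ k j : ℕ, ((j : K) + 1) * P (k + 1) (j + 1) = -((k : K) + 1) * P (k + 1 + 1) j := by
    intro k j
    have hw : ∀ w : List Bool, ((k : K) + 1) * I (replicate (k + 1 + 1) true ++ w)
        + ((ins1 true w).map (fun s => I (replicate (k + 1) true ++ s))).sum = 0 := by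
      intro w
      have h := hreg (replicate (k + 1) true ++ w)
      rw [h1, zero_mul, sum_ins1_replicate_append] at h
      push_cast at h
      linear_combination h
    have h0 : ((arr i j).map (fun w => ((k : K) + 1) * I (replicate (k + 1 + 1) true ++ w)
        + ((ins1 true w).map (fun s => I (replicate (k + 1) true ++ s))).sum)).sum = 0 := by
      simp [hw]
    rw [sum_map_add, sum_map_mul_left, ins1_arr_sum] at h0
    show ((j : K) + 1) * ((arr i (j + 1)).map (fun w => I (replicate (k + 1) true ++ w))).sum
      = -((k : K) + 1) * ((arr i j).map (fun w => I (replicate (k + 1 + 1) true ++ w))).sum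
    linear_combination h0
  -- iterate: P (k+1) j = (-1)^j C(k+j, j) I (1^(k+j+1) 0^i)
  have E : ∀ j k : ℕ, P (k + 1) j
      = (-1 : K) ^ j * (Nat.choose (k + j) j : K) * I (replicate (k + j + 1) true ++ replicate i false) := by
    intro j
    induction j with
    | zero =>
      intro k
      show ((arr i 0).map (fun w => I (replicate (k + 1) true ++ w))).sum = _
      simp [arr_any_zero]
    | succ j ih =>
      intro k
      have hk := key k j
      have ih' := ih (k + 1)
      have e1 : k + 1 + j = k + j + 1 := by omega
      rw [e1] at ih'
      rw [ih'] at hk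
      -- binomial identity (j+1) C(k+j+1, j+1) = (k+1) C(k+j+1, j)
      have hcN : Nat.choose (k + j + 1) (j + 1) * (j + 1) = Nat.choose (k + j + 1) j * (k + 1) := by
        have := Nat.choose_succ_right_eq (k + j + 1) j
        rw [this]
        congr 1
        omega
      have hc : ((j : K) + 1) * (Nat.choose (k + j + 1) (j + 1) : K)
          = ((k : K) + 1) * (Nat.choose (k + j + 1) j : K) := by
        have := congrArg (fun n : ℕ => (n : K)) hcN
        push_cast at this
        linear_combination this
      have hj : ((j : K) + 1) ≠ 0 := by
        have : ((j + 1 : ℕ) : K) ≠ 0 := Nat.cast_ne_zero.mpr (Nat.succ_ne_zero j)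
        push_cast at this
        exact this
      apply mul_left_cancel₀ hj
      have e3 : k + (j + 1) = k + j + 1 := by omega
      rw [e3, hk]
      linear_combination (-((-1 : K) ^ (j + 1) * I (replicate (k + j + 1 + 1) true ++ replicate i false))) * hc
  have hE := E j 0
  simp only [zero_add, Nat.choose_self, Nat.cast_one, mul_one] at hE
  -- P 1 j is the first-letter sum
  have hP : P 1 j = ((arr i j).map (fun w => I (true :: w))).sum := by
    show ((arr i j).map (fun w => I (replicate 1 true ++ w))).sum = _
    simp
  rw [← hP, hE]

/-- The same statement for a genuine shuffle character (`I u * I v = Σ_{s ∈ u ш v} I s`) with `I [1] = 0`,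
over the shuffle set `0^i ш 1^j` itself. -/
theorem firstLetter_sum_eq_of_character (I : List Bool → K)
    (hmul : ∀ u v : List Bool, I u * I v = ((shuf u v).map I).sum) (h1 : I [true] = 0) (i j : ℕ) :
    ((shuf (replicate i false) (replicate j true)).map (fun w => I (true :: w))).sum
      = (-1 : K) ^ j * I (replicate (j + 1) true ++ replicate i false) := by
  rw [shuf_replicate]
  refine firstLetter_sum_eq I h1 (fun w => ?_) i j
  rw [← shuf_singleton]
  exact (hmul [true] w).symm

/-- Sanity instance (weight 5, depth 3, the hand check `K_{5,3} = I(11100)` of the s121 audit):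
`I(11100)+I(11010)+I(10110)+I(11001)+I(10101)+I(10011) = I(11100)`. -/
example (I : List Bool → ℚ) (hmul : ∀ u v : List Bool, I u * I v = ((shuf u v).map I).sum)
    (h1 : I [true] = 0) :
    ((shuf [false, false] [true, true]).map (fun w => I (true :: w))).sum
      = I [true, true, true, false, false] := by
  have := firstLetter_sum_eq_of_character I hmul h1 2 2
  simpa [replicate_succ] using this

end character

end FirstLetterShuffle

end Summit.KontsevichZagierPeriods.KontsevichZagierPeriods.Theorems
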